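import Literature.NumberTheory.Automorphic.UnitaryGroupCohomologicalForms
import Literature.AlgebraicGeometry.ShimuraVarieties.UnitaryBallCotangentReproducingKernelProbe
import Literature.Analysis.Complex.BallRadialMeanValue
import HarnessLib

/-!
# Holomorphic cotangent forms of `U(J)` are REPRODUCED along `U(2,1)`-orbits by a compactly supported smooth matrix kernel
# (floor-0 (D) desk, road (h) «holomorphic reproduction», stub h1 `holCotForms_reproducing`)

Topic `NumberTheory/Automorphic`; namespace `Literature.NumberTheory.Automorphic.UnitaryGroup.CotangentForms`.  THEOREMS ONLY (no `def`,
no instance, no notation, no named fact, no `sorry`); imports ★ `UnitaryGroupCohomologicalForms` ((A): `holCotForms`, `IsHolGerm`, `germAt`),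
★ `UnitaryBallCotangentReproducingKernel` (the kernel `reproducingKernel κ`, its continuity ∕ support ∕ `K`-equivariance ∕ smoothness, the
profile constant `profileIntegral`), ★ `BallRadialMeanValue` (F0P2-p01 (g2): the Euclidean-radial weighted mean value property on `ℂ²`).

THE THEOREM (`holCotForms_reproducing`; F0P2-p03 (g2) on F0P2-plan (g2)'s (D)-desk cut, CENSUS-R v2 §3(h)∕§6 of F0P2-p01 (g2)).  For the
generic unitary datum `(F, E, c, N, J)`, ANY homomorphism `ιinf : U(2,1) → U(J)(𝔸_F)`, any `K_c`, and ANY Haar measure `μ` on `U(2,1)`, there is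
a continuous compactly supported matrix kernel `A : U(2,1) → M₂(ℂ)` — vanishing off `{|u·x₀|² ≤ 1/4}`, the restriction of a matrix function
smooth at `mat(U(2,1))`, and `K`-equivariant for the cotangent weight `τ = weightOf x₀` — such that for EVERY `Φ ∈ holCotForms … ιinf K_c` and
EVERY base point `y`:  `u ↦ A(u) · Φ(y · ιinf u)` is `μ`-integrable and  `∫_{U(2,1)} A(u) · Φ(y · ιinf u) dμ(u) = Φ(y)`.
Named form: `integral_reproducingKernel_mulVec` (`A = reproducingKernel κ` for every `κ`, with the constant `c_μ κ C_β` explicit).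

PROOF (elementary; no `(𝔤,K)`-module theory, no regularity theorem).  (1) ORBIT BY ORBIT TO THE BALL: by the weight clause of `holCotForms`
(`weightForms` along `ιinf ∘ Stab(x₀)`, weight `τ`), `f_y(u) := Φ(y·ιinf u)` is a weight form on `U(2,1)` (`orbitFun_mem_weightForms`), hence
`f_y(u) = (Jac u x₀)ᵀ F_y(u·x₀)` for the section `F_y = ofGroupFun …` of ★ `AutomorphyFactorForms` on `𝔹²`; the clause `IsHolGerm` says every
probe `b ↦ Φ(y′·ιinf(expP b))` is real-differentiable at `0` with `ℂ`-LINEAR differential, i.e. `ℂ`-differentiable there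
(`IsHolGerm.differentiableAt_complex`), which is exactly the hypothesis of ★ `UnitaryBallCauchyRiemann.mem_holomorphic_of_differentiableAt_expP`:
`F_y` is HOLOMORPHIC on the ball (`exists_ballFun_of_mem_holCotForms`) [Borel1997, §5.14].  (2) THE INTEGRAND is `A_κ(u) f_y(u) =
(κ W(u·x₀)) • F_y(u·x₀)` (`coT · Jacᵀ = 1`).  (3) GROUP → BALL: `(· x₀)_* μ = c_μ dβ` (★ `map_orbit_haar_eq_smul_bergmanVolume`, [Helgason2000,
I Thm 1.9]; [Rudin1980, Thm 2.2.6]) and `dβ = 9(1−|z|²)⁻³ dv` (★ `bergmanVolume`), so the integral is `c_μ κ ∫_{𝔹²} β(|z|²) F_y(z) dv(z)` — the weight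
`W` was built to cancel the Bergman density.  (4) MEAN VALUE: `β(|z|²)` is supported in `|z|² ≤ 1/4`, so this is an integral over `ℂ²` of a
EUCLIDEAN-radial weight against the holomorphic `F_y`, `= C_β • F_y(0)` (★ `integral_euclidRadial_smul_eq_smul`, [Rudin1980, §1.4]).  (5)
`F_y(0) = f_y(1) = Φ(y)` and `κ := (c_μ C_β)⁻¹`.  Integrability: the integrand is continuous with compact support.
HC_CM is proved only modulo the printed citations until rung 0 closes.

## References
* [Borel1997] A. Borel, *Automorphic forms on SL₂(ℝ)* (1997), §5.14.
* [Rudin1980] W. Rudin, *Function Theory in the Unit Ball of ℂⁿ* (1980), §1.4, Thm. 2.2.6.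
* [Helgason2000] S. Helgason, *Groups and Geometric Analysis* (2000), Ch. I §1 Thm. 1.9.
* [BorelJacquet1979] A. Borel, H. Jacquet, PSPM 33.1 (1979), §4.2 (right translation of automorphic forms).
-/

set_option autoImplicit false

noncomputable section

open MeasureTheory NumberField MulAction Matrix
open scoped Matrix Matrix.Norms.Operator ComplexConjugate ContDiff
open Literature.Geometry.ComplexHyperbolic
open Literature.Geometry.ComplexHyperbolic.BallModel
open Literature.AlgebraicGeometry.ShimuraVarieties
open Literature.AlgebraicGeometry.ShimuraVarieties.BallForms (reproducingKernel ballWeight bumpProfile profileIntegral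
  reproducingKernel_continuous reproducingKernel_hasCompactSupport reproducingKernel_equivariant reproducingKernel_eq_zero
  ballWeight_continuous ballWeight_mul_bergmanDensity bumpProfile_eq_zero bumpProfile_continuous continuous_smul_x₀
  profileIntegral_pos reproducingKernel_eq_extKernel contDiffAt_extKernel extKernel contDiff_reproducingKernel_probe
  continuous_fderiv_reproducingKernel_probe)

namespace Literature.NumberTheory.Automorphic.UnitaryGroup.CotangentForms

/-! ## §1 From `IsHolGerm` on the group to a holomorphic function on the ball, orbit by orbit -/

/-- A real continuous linear map `ℂ² → ℂ²` commuting with `i` is complex linear. [cite: Borel1997, §5.14] -/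
theorem exists_restrictScalars_eq_of_map_I_smul (L : (Fin 2 → ℂ) →L[ℝ] (Fin 2 → ℂ))
    (hL : ∀ v, L (Complex.I • v) = Complex.I • L v) :
    ∃ g : (Fin 2 → ℂ) →L[ℂ] (Fin 2 → ℂ), g.restrictScalars ℝ = L := by
  refine ⟨{ toFun := L, map_add' := fun a b => map_add L a b, map_smul' := ?_, cont := L.cont }, ?_⟩
  · intro c v
    have hdec : c • v = (c.re : ℝ) • v + (c.im : ℝ) • (Complex.I • v) := by
      rw [← Complex.coe_smul, ← Complex.coe_smul, smul_smul, ← add_smul, Complex.re_add_im]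
    rw [hdec, map_add, L.map_smul, L.map_smul, hL, RingHom.id_apply]
    conv_rhs => rw [← Complex.re_add_im c]
    rw [add_smul, mul_smul, Complex.coe_smul, Complex.coe_smul]
  · ext v
    rfl

open Literature.NumberTheory.Automorphic.AutomorphyFactor

section Generic

variable {G : Type*} [Group G] {ιG : U21 →* G}

/-- **`IsHolGerm` ⇒ the probes are `ℂ`-differentiable at `0`** (real-differentiable with `ℂ`-linear differential). [cite: Borel1997, §5.14] -/
theorem IsHolGerm.differentiableAt_complex {Φ : G → (Fin 2 → ℂ)} (hΦ : IsHolGerm ιG Φ) (y : G) :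
    DifferentiableAt ℂ (germAt ιG Φ y) 0 := by
  rw [differentiableAt_iff_restrictScalars ℝ (hΦ.1 y)]
  exact exists_restrictScalars_eq_of_map_I_smul _ (hΦ.2 y)

/-- **The orbit function of a cotangent-weight function is a weight form on `U(2,1)`**: if `Φ (g · ιG k) = τ(k⁻¹) (Φ g)` for
`k ∈ Stab(x₀)` (`τ = weightOf x₀`), then for every base point `y`, `u ↦ Φ (y · ιG u)` is of right `Stab(x₀)`-type `τ` (`Γ = ⊥`).
[cite: Borel1997, §5.14] -/
theorem orbitFun_mem_weightForms {Φ : G → (Fin 2 → ℂ)}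
    (hw : ∀ (k : stabilizer (↥U21) x₀) (g : G),
      Φ (g * ιG k) = BallForms.isPullbackCocycle_cotangentCocycle.weightOf x₀ k⁻¹ (Φ g)) (y : G) :
    (fun u : U21 => Φ (y * ιG u)) ∈ Literature.NumberTheory.Automorphic.weightForms (⊥ : Subgroup U21)
      (stabilizer (↥U21) x₀).subtype (BallForms.isPullbackCocycle_cotangentCocycle.weightOf x₀) := by
  refine WeightForms.mem_iff.mpr ⟨fun γ hγ g => ?_, fun k g => ?_⟩
  · rw [Subgroup.mem_bot] at hγ
    simp only [hγ, one_mul]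
  · simp only [Subgroup.coe_subtype, map_mul, ← mul_assoc]
    exact hw k (y * ιG g)

/-- **The ball avatar along an orbit.**  For `Φ : G → ℂ²` of right cotangent type along `ιG ∘ Stab(x₀)` with holomorphic germs along
`ιG` and a base point `y`, there is a HOLOMORPHIC `F_y : 𝔹² → ℂ²` with `(Jac u x₀)ᵀ F_y(u·x₀) = Φ (y · ιG u)` for all `u` (★ `ofGroupFun`
along a section; holomorphy by ★ `mem_holomorphic_of_differentiableAt_expP`, whose hypothesis is exactly `IsHolGerm` at the points
`y · ιG u`). [cite: Borel1997, §5.14] -/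
theorem exists_ballFun_of_weight_isHolGerm {Φ : G → (Fin 2 → ℂ)}
    (hw : ∀ (k : stabilizer (↥U21) x₀) (g : G),
      Φ (g * ιG k) = BallForms.isPullbackCocycle_cotangentCocycle.weightOf x₀ k⁻¹ (Φ g))
    (hhol : IsHolGerm ιG Φ) (y : G) :
    ∃ Fy : Ball → (Fin 2 → ℂ), Fy ∈ BallForms.holomorphic (Fin 2 → ℂ) ∧
      ∀ u : U21, (Jac u x₀)ᵀ *ᵥ Fy (u • x₀) = Φ (y * ιG u) := by
  obtain ⟨s, hs⟩ := BallForms.exists_section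
  have hf := orbitFun_mem_weightForms hw y
  set Fy : Ball → (Fin 2 → ℂ) := ofGroupFun BallForms.cotangentCocycle s (fun u : U21 => Φ (y * ιG u)) with hFy
  have htg : ∀ u : U21, toGroupFun BallForms.cotangentCocycle x₀ Fy u = Φ (y * ιG u) := fun u => by
    have h := ofGroupFun_eq BallForms.isPullbackCocycle_cotangentCocycle hs hf (g := u) rfl
    rw [← hFy] at h
    rw [toGroupFun_apply, h, BallForms.isPullbackCocycle_cotangentCocycle.apply_inv_apply]
  refine ⟨Fy, ?_, fun u => ?_⟩
  · refine BallForms.mem_holomorphic_of_differentiableAt_expP Fy fun g => ?_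
    have heq : (fun b : Fin 2 → ℂ => toGroupFun BallForms.cotangentCocycle x₀ Fy (g * BallForms.expP b)) =
        germAt ιG Φ (y * ιG g) := by
      funext b
      rw [htg, germAt_apply, map_mul, mul_assoc]
    rw [heq]
    exact hhol.differentiableAt_complex (y * ιG g)
  · rw [← htg u, toGroupFun_apply, BallForms.cotangentCocycle_apply]

end Generic

/-! ## §2 Group integral → Bergman integral → Lebesgue integral on the ball -/

section Integral

variable {V : Type*} [NormedAddCommGroup V] [NormedSpace ℝ V]

/-- **Group integral → Bergman integral**: `∫_{U(2,1)} G(u·x₀) dμ(u) = c_μ · ∫_{𝔹²} G dβ` when `(· x₀)_* μ = c_μ • dβ`.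
[cite: Helgason2000, Ch. I §1 Thm. 1.9] -/
theorem integral_comp_smul_x₀ (μ : Measure U21) {cμ : ENNReal} (hc : μ.map (fun g : U21 => g • x₀) = cμ • bergmanVolume)
    {Gf : Ball → V} (hG : Continuous Gf) :
    ∫ u, Gf (u • x₀) ∂μ = cμ.toReal • ∫ z, Gf z ∂bergmanVolume := by
  rw [← integral_map continuous_smul_x₀.measurable.aemeasurable hG.aestronglyMeasurable, hc, integral_smul_measure]

/-- **Bergman integral → Lebesgue integral on the ball**: `∫ G dβ = ∫ 9(1−|z|²)⁻³ • G dv`. [cite: Rudin1980, Thm. 2.2.6] -/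
theorem integral_bergmanVolume (Gf : Ball → V) :
    ∫ z, Gf z ∂bergmanVolume = ∫ z, bergmanDensity z • Gf z ∂ballVolume := by
  rw [bergmanVolume, integral_withDensity_eq_integral_toReal_smul measurable_bergmanDensity.ennreal_ofReal
    (Filter.Eventually.of_forall fun _ => ENNReal.ofReal_lt_top)]
  refine integral_congr_ae (Filter.Eventually.of_forall fun z => ?_)
  simp only [ENNReal.toReal_ofReal (bergmanDensity_pos z).le]

end Integral

/-! ## §3 The reproduction identity -/

section Main

variable {G : Type*} [Group G] {ιG : U21 →* G}

/-- the integrand of the reproduction identity is the ball function `z ↦ (κ W(z)) • F_y(z)` read on the orbit. [cite: Borel1997, §5.14] -/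
theorem reproducingKernel_mulVec_eq (κ : ℝ) {Fy : Ball → (Fin 2 → ℂ)} {Φ : G → (Fin 2 → ℂ)} {y : G}
    (hFg : ∀ u : U21, (Jac u x₀)ᵀ *ᵥ Fy (u • x₀) = Φ (y * ιG u)) (u : U21) :
    reproducingKernel κ u *ᵥ Φ (y * ιG u) = (κ * ballWeight (u • x₀)) • Fy (u • x₀) := by
  rw [← hFg u, reproducingKernel, smul_mulVec, mulVec_mulVec, coT_mul_transpose_Jac, one_mulVec, Complex.coe_smul]

/-- **The reproduction identity with constants**: for `Φ : G → ℂ²` of right cotangent type along `ιG ∘ Stab(x₀)` with holomorphic germs,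
`∫ A_κ(u) Φ(y·ιG u) dμ(u) = (c_μ κ C_β) • Φ(y)` (`(· x₀)_* μ = c_μ dβ`; mean value on the ball, ★ `integral_euclidRadial_smul_eq_smul`).
[cite: Rudin1980, §1.4] [cite: Borel1997, §5.14] -/
theorem integral_reproducingKernel_mulVec (μ : Measure U21) {cμ : ENNReal}
    (hc : μ.map (fun g : U21 => g • x₀) = cμ • bergmanVolume) (κ : ℝ) {Φ : G → (Fin 2 → ℂ)}
    (hw : ∀ (k : stabilizer (↥U21) x₀) (g : G),
      Φ (g * ιG k) = BallForms.isPullbackCocycle_cotangentCocycle.weightOf x₀ k⁻¹ (Φ g))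
    (hhol : IsHolGerm ιG Φ) (y : G) :
    ∫ u, reproducingKernel κ u *ᵥ Φ (y * ιG u) ∂μ = (cμ.toReal * κ * profileIntegral) • Φ y := by
  obtain ⟨Fy, hFh, hFg⟩ := exists_ballFun_of_weight_isHolGerm hw hhol y
  have hFc : Continuous Fy := BallForms.continuous_of_mem_holomorphic hFh
  -- (1) the integrand is `Gf (u • x₀)`
  simp_rw [reproducingKernel_mulVec_eq κ hFg]
  -- (2) group → Bergman → Lebesgue on the ball
  rw [integral_comp_smul_x₀ μ hc (Gf := fun z => (κ * ballWeight z) • Fy z)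
    ((continuous_const.mul ballWeight_continuous).smul hFc), integral_bergmanVolume]
  have hdens : ∀ z : Ball, bergmanDensity z • ((κ * ballWeight z) • Fy z) = (κ * bumpProfile (nsq z.1)) • Fy z := by
    intro z
    rw [smul_smul, ← ballWeight_mul_bergmanDensity z]
    congr 1
    ring
  simp_rw [hdens]
  -- (3) to `ℂ²` through `extend`, then the whole plane (the profile vanishes off `|w|² < 1/4`)
  have hext : ∀ z : Ball, (κ * bumpProfile (nsq z.1)) • Fy z =
      (fun w : Fin 2 → ℂ => (κ * bumpProfile (nsq w)) • BallForms.extend (Fin 2 → ℂ) Fy w) z.1 := fun z => by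
    simp only [BallForms.extend_apply_coe]
  simp_rw [hext]
  have hball := integral_ballVolume (fun w : Fin 2 → ℂ => (κ * bumpProfile (nsq w)) • BallForms.extend (Fin 2 → ℂ) Fy w)
  rw [hball, setIntegral_eq_integral_of_forall_compl_eq_zero fun w hw => ?_]
  swap
  · simp only [Set.mem_setOf_eq, not_lt] at hw
    rw [bumpProfile_eq_zero (by linarith), mul_zero, zero_smul]
  -- (4) the weighted mean value property on `ℂ²`
  simp_rw [mul_smul]
  rw [integral_smul]
  have hmv := Literature.Analysis.Complex.integral_euclidRadial_smul_eq_smul (F := Fin 2 → ℂ) bumpProfile_continuous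
    (R₁ := 1 / 2) (R := 3 / 5) (by norm_num) (by norm_num) (fun t ht => bumpProfile_eq_zero (by nlinarith))
    (f := BallForms.extend (Fin 2 → ℂ) Fy) BallForms.isOpen_ballSet (BallForms.mem_holomorphic_iff.mp hFh) (fun w hw => ?_)
  swap
  · rw [Metric.mem_closedBall, dist_zero_right, pi_norm_le_iff_of_nonneg (by norm_num : (0 : ℝ) ≤ 3 / 5)] at hw
    have h0 := hw 0
    have h1 := hw 1
    show nsq w < 1
    unfold nsq; nlinarith [norm_nonneg (w 0), norm_nonneg (w 1)]
  have hmv' : ∫ w : Fin 2 → ℂ, bumpProfile (nsq w) • BallForms.extend (Fin 2 → ℂ) Fy w =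
      profileIntegral • BallForms.extend (Fin 2 → ℂ) Fy 0 := hmv
  rw [hmv']
  -- (5) the value at the origin: `extend F_y 0 = F_y x₀ = Φ y`
  have h0 : BallForms.extend (Fin 2 → ℂ) Fy 0 = Φ y := by
    have h1 : BallForms.extend (Fin 2 → ℂ) Fy (x₀ : Ball).1 = Fy x₀ := BallForms.extend_apply_coe Fy x₀
    have h2 := hFg 1
    rw [Jac_one, transpose_one, one_mulVec, one_smul, map_one, mul_one] at h2
    rw [← h2, ← h1]
    rfl
  rw [h0, smul_smul, smul_smul, mul_assoc]

/-- **Integrability of the reproduction integrand** (continuous with compact support against a Haar measure). [cite: Borel1997, §5.14] -/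
theorem integrable_reproducingKernel_mulVec (μ : Measure U21) [μ.IsHaarMeasure] (κ : ℝ) {Φ : G → (Fin 2 → ℂ)}
    (hw : ∀ (k : stabilizer (↥U21) x₀) (g : G),
      Φ (g * ιG k) = BallForms.isPullbackCocycle_cotangentCocycle.weightOf x₀ k⁻¹ (Φ g))
    (hhol : IsHolGerm ιG Φ) (y : G) :
    Integrable (fun u : U21 => reproducingKernel κ u *ᵥ Φ (y * ιG u)) μ := by
  obtain ⟨Fy, hFh, hFg⟩ := exists_ballFun_of_weight_isHolGerm hw hhol y
  have hFc : Continuous Fy := BallForms.continuous_of_mem_holomorphic hFh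
  have hcont : Continuous fun u : U21 => reproducingKernel κ u *ᵥ Φ (y * ιG u) := by
    simp_rw [reproducingKernel_mulVec_eq κ hFg]
    exact ((continuous_const.mul (ballWeight_continuous.comp continuous_smul_x₀)).smul (hFc.comp continuous_smul_x₀))
  refine hcont.integrable_of_hasCompactSupport ?_
  refine (reproducingKernel_hasCompactSupport κ).mono fun u hu => ?_
  rw [Function.mem_support] at hu ⊢
  intro h0
  exact hu (by rw [h0, zero_mulVec])

/-- **The reproducing constant** `κ_μ = (c_μ C_β)⁻¹` of a Haar measure `μ` on `U(2,1)` (`c_μ` the orbit push-forward constant of ★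
`map_orbit_haar_eq_smul_bergmanVolume`, `C_β` the profile constant); characterised by `integral_reproducingKernel_kappa_mulVec`.
[cite: Helgason2000, Ch. I §1 Thm. 1.9] -/
theorem exists_kappa_reproducing (μ : Measure U21) [μ.IsHaarMeasure] :
    ∃ κ : ℝ, ∀ (G : Type) [Group G] (ιG : U21 →* G) (Φ : G → (Fin 2 → ℂ)),
      (∀ (k : stabilizer (↥U21) x₀) (g : G),
          Φ (g * ιG k) = BallForms.isPullbackCocycle_cotangentCocycle.weightOf x₀ k⁻¹ (Φ g)) →
      IsHolGerm ιG Φ → ∀ y : G, ∫ u, reproducingKernel κ u *ᵥ Φ (y * ιG u) ∂μ = Φ y := by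
  obtain ⟨cμ, hc0, hct, hc⟩ := BallForms.map_orbit_haar_eq_smul_bergmanVolume μ
  have hcR : cμ.toReal ≠ 0 := ENNReal.toReal_ne_zero.2 ⟨hc0, hct⟩
  refine ⟨(cμ.toReal * profileIntegral)⁻¹, fun G _ ιG Φ hw hhol y => ?_⟩
  rw [integral_reproducingKernel_mulVec μ hc _ hw hhol y]
  have h1 : cμ.toReal * (cμ.toReal * profileIntegral)⁻¹ * profileIntegral = 1 := by
    field_simp [hcR, profileIntegral_pos.ne']
  rw [h1, one_smul]

/-- **STUB (K) OF THE (D) DESK — `StubKReproducingKernel` with the Lines-local bundles `IsRegularKernel` ∕ `IsReproducedAlong` UNFOLDED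
(s347: the line `Cruxes/H413/Lines/F0_P2SpectralProjectionD.lean` folds `stub_K_reproducingKernel` by name from this theorem with the
anonymous constructor).**  For every Haar measure `ν` on `U(2,1)` there is a matrix kernel `A` (:= `reproducingKernel κ_ν`) that is
continuous, compactly supported, `C¹` along the left `𝔭`-probes with jointly continuous probe derivative, and reproduces, for EVERY group
`G` and EVERY `ιG : U(2,1) →* G`, every `Φ : G → ℂ²` of right cotangent `K_∞`-type `τ = weightOf x₀` with holomorphic germs along `ιG`:
`∫ A(u) · Φ(y · ιG u) dν(u) = Φ(y)`. [cite: Borel1997, §2.13–2.14 and §5.14] [cite: Rudin1980, §1.4, Thm. 2.2.6] [cite: Helgason2000, Ch. I §1 Thm. 1.9] -/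
theorem stubK_reproducingKernel_holds :
    ∀ (ν : Measure U21) [ν.IsHaarMeasure],
      ∃ A : U21 → Matrix (Fin 2) (Fin 2) ℂ,
        (Continuous A ∧ HasCompactSupport A ∧
          (∀ (j i : Fin 2) (u' : U21), ContDiff ℝ 1 fun b : Fin 2 → ℂ => A (BallForms.expP b * u') j i) ∧
          ∀ j i : Fin 2, Continuous fun p : (Fin 2 → ℂ) × U21 =>
            fderiv ℝ (fun b : Fin 2 → ℂ => A (BallForms.expP b * p.2) j i) p.1) ∧
        ∀ (G : Type) [Group G] (ιG : U21 →* G), ∀ Φ : G → (Fin 2 → ℂ),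
          (∀ (k : stabilizer (↥U21) x₀) (g : G),
              Φ (g * ιG k) = BallForms.isPullbackCocycle_cotangentCocycle.weightOf x₀ k⁻¹ (Φ g)) →
          IsHolGerm ιG Φ →
            ∀ y : G, ∫ u, A u *ᵥ Φ (y * ιG u) ∂ν = Φ y := by
  intro ν _
  obtain ⟨κ, hκ⟩ := exists_kappa_reproducing ν
  exact ⟨reproducingKernel κ, ⟨reproducingKernel_continuous κ, reproducingKernel_hasCompactSupport κ,
    fun j i u' => contDiff_reproducingKernel_probe κ j i u' (by exact_mod_cast le_top),
    fun j i => continuous_fderiv_reproducingKernel_probe κ j i⟩, fun G _ ιG Φ hw hhol y => hκ G ιG Φ hw hhol y⟩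

end Main

/-! ## §4 The reproduction of holomorphic cotangent forms of `U(J)` -/

section HolCotForms

variable {F E : Type} [Field F] [NumberField F] [Field E] [NumberField E] [Algebra F E]
  {c : E ≃ₐ[F] E} {N : ℕ} {J : Matrix (Fin N) (Fin N) E}
  {ιinf : U21 →* (adelicGroupData F E c N J).Adelic} {Kc : Subgroup (adelicGroupData F E c N J).Adelic}

/-- the weight clause of `holCotForms`, read as the pointwise identity `Φ (g · ιinf k) = τ(k⁻¹) (Φ g)`. [cite: Borel1997, §5.14] -/
theorem weight_of_mem_holCotForms {Φ : (adelicGroupData F E c N J).Adelic → (Fin 2 → ℂ)}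
    (hΦ : Φ ∈ holCotForms F E c N J ιinf Kc) (k : stabilizer (↥U21) x₀) (g : (adelicGroupData F E c N J).Adelic) :
    Φ (g * ιinf k) = BallForms.isPullbackCocycle_cotangentCocycle.weightOf x₀ k⁻¹ (Φ g) := by
  have h := (WeightForms.mem_iff.mp (mem_holCotForms_iff.mp hΦ).1).2 k g
  simpa only [MonoidHom.coe_comp, Function.comp_apply, Subgroup.coe_subtype] using h

/-- **THE REPRODUCING KERNEL THEOREM for holomorphic cotangent forms of `U(J)`.**  For the generic unitary datum `(F, E, c, N, J)`, any
`ιinf : U(2,1) →* U(J)(𝔸_F)`, any `K_c` and ANY Haar measure `μ` on `U(2,1)`, there is a continuous compactly supported matrix kernel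
`A : U(2,1) → M₂(ℂ)`, vanishing off the compact `{|u·x₀|² ≤ 1/4}`, restriction of a matrix function `C^∞` at `mat(U(2,1))`, `K`-equivariant for
the cotangent weight (`A(k u) = τ(k) ∘ A(u)`), such that for EVERY `Φ ∈ holCotForms … ιinf K_c` and every `y`, `u ↦ A(u) · Φ(y · ιinf u)` is
`μ`-integrable and `∫_{U(2,1)} A(u) · Φ(y · ιinf u) dμ(u) = Φ(y)`. [cite: Borel1997, §2.13–2.14 and §5.14] [cite: Rudin1980, §1.4, Thm. 2.2.6]
[cite: Helgason2000, Ch. I §1 Thm. 1.9] -/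
theorem holCotForms_reproducing (F E : Type) [Field F] [NumberField F] [Field E] [NumberField E] [Algebra F E]
    (c : E ≃ₐ[F] E) (N : ℕ) (J : Matrix (Fin N) (Fin N) E) (ιinf : U21 →* (adelicGroupData F E c N J).Adelic)
    (Kc : Subgroup (adelicGroupData F E c N J).Adelic) (μ : Measure U21) [μ.IsHaarMeasure] :
    ∃ A : U21 → Matrix (Fin 2) (Fin 2) ℂ,
      Continuous A ∧ HasCompactSupport A ∧
      (∀ u : U21, 1 / 4 ≤ nsq (u • x₀).1 → A u = 0) ∧
      (∃ Ã : Matrix (Fin 3) (Fin 3) ℂ → Matrix (Fin 2) (Fin 2) ℂ,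
          (∀ u : U21, ContDiffAt ℝ ∞ Ã (mat u)) ∧ ∀ u : U21, A u = Ã (mat u)) ∧
      (∀ (k : stabilizer U21 x₀) (u : U21) (v : Fin 2 → ℂ),
          A ((k : U21) * u) *ᵥ v = BallForms.isPullbackCocycle_cotangentCocycle.weightOf x₀ k (A u *ᵥ v)) ∧
      ∀ Φ ∈ holCotForms F E c N J ιinf Kc, ∀ y : (adelicGroupData F E c N J).Adelic,
        Integrable (fun u => A u *ᵥ Φ (y * ιinf u)) μ ∧ ∫ u, A u *ᵥ Φ (y * ιinf u) ∂μ = Φ y := by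
  obtain ⟨κ, hκ⟩ := exists_kappa_reproducing μ
  refine ⟨reproducingKernel κ, reproducingKernel_continuous κ, reproducingKernel_hasCompactSupport κ,
    fun u hu => reproducingKernel_eq_zero hu, ⟨extKernel κ, contDiffAt_extKernel κ, reproducingKernel_eq_extKernel κ⟩,
    reproducingKernel_equivariant κ, fun Φ hΦ y => ⟨?_, ?_⟩⟩
  · exact integrable_reproducingKernel_mulVec μ κ (weight_of_mem_holCotForms hΦ) (mem_holCotForms_iff.mp hΦ).2.2.2 y
  · exact hκ _ ιinf Φ (weight_of_mem_holCotForms hΦ) (mem_holCotForms_iff.mp hΦ).2.2.2 y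

end HolCotForms

end Literature.NumberTheory.Automorphic.UnitaryGroup.CotangentForms

end
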